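import Summits.QuantumFields.YangMills.Theorems.FluctuationComparisonRegPrIntLS2BetaRelativeKeyLemmaTorusHist
import Summits.QuantumFields.YangMills.Theorems.FluctuationComparisonRegPrIntLS2BetaRelativeKeyLemmaSuppliers
import HarnessLib

/-!
# S2β · letter (D♮)∕(D-stage) REL-TEL, the (C)-half — ★★★ THE WINDOW-FREE RELATIVE KEY LEMMA TOWER IN STAGE-GAUGE CURRENCY:
# ✓∕⧗`relKeyLemma_torus_hist` at the pair `(g 0 • U, g₀ 0 • U₀)` with the three LOCAL SUPPLIERS of ✓∕⧗`…RelativeKeyLemmaSuppliers` plugged in, the towers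
# rewritten level by level by the stage-gauge commutation `M^j(g 0 • X) = g j • M^jX` ((T3) of px12 g24's `AxStage` ∕ px17 g19's ✓`exists_stageGaugeTower`)

Cell `ym3-torus` (rung R3 = continuum `SU(2)` Yang–Mills on the three-torus — NOT d = 4, NOT infinite volume, NOT a mass gap, NOT Clay).
Width seat «width 10» `ym3-torus-px10` (gen 24), FREE px helper on crux `stmt-QuantumFields-20520`, count-neutral, DEFINITION-FREE; own-risk brick of the px10 lane
(the KEYREL supplier road, UV3-NODE §82.7 (3)).  INPUTS (`SU(N)`, `P.d = 3`, `m ≤ P.m + P.K`): two gauge families `g, g₀` commuting with the `exp[mean log]` tower on `U`,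
`U₀` ((T3)); per level `t < m` a history threshold `θ_t` (`PlaqSmall θ_t (g t • M^tU)`, `((d+2)L)²θ_t ≤ 1∕800`, guard) and a background size `0 < θ₀,t ≤ θ_t`
(`PlaqSmall θ₀,t (g₀ t • M^tU₀)`).  OUTPUT for every `t ≤ m`, in the DOOR's currency (relative plaquettes `dist1(X₀(∂q)⁻¹·X(∂q))`, chords `dist1(X b·X₀ b⁻¹)`):
`A_t ≤ exp(Σ_{i<m} θ-linear) · ((√L)^t·A_0 + Σ_{s<t}(√L)^{t−1−s}·qd_s·B_s)`, `qd_s = (1.4·10⁶((d+2)L)²θ_s·cWβ_s + 7·10⁵((d+2)L)²θ₀,s·(d+2)L + 5L³θ₀,s)·√N_b`,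
`cWβ_s = ((d+2)L)²∕4·2θ₀,s·((d+2)L+2)` — so `qd_s ∝ θ₀,s`; NO window, NO sup-closeness of the two towers.
* ★★★ `relKeyLemma_torus_gauged`.

HONEST SCOPE.  Instantiation + per-summand rewriting; nothing of Bałaban's renormalisation analysis asserted; the thresholds, the BKG-tower letter, KEYREL, (H♭♭), (D-stage),
GAP♯∘ (`stub_uniformFibreGapOrbit`), S2β, crux 20520 and `YM3TorusSU2` are NOT proved; no registered stub is closed; the Yang–Mills mass gap is NOT proved.  Sorry-free,
axioms standard.  References: T. Bałaban, CMP **98** (1985) 17–51 [Balaban1985Averaging] ((19) p.21); CMP **99** (1985) 75–102 [Balaban1985RegularSpaces] (Lemma 1 p.79);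
CMP **109** (1987) 249–301 [Balaban1987RG1] ((0.4) p.253).
-/

set_option autoImplicit false

noncomputable section

namespace Summit.QuantumFields.YangMills.Theorems.FluctuationComparisonRegPrIntLS2BetaRelativeKeyLemmaTorusGauged

open Finset
open Literature.MathematicalPhysics.QuantumFieldTheory.Balaban1983to89
open T4Continuum BlockAveraging AveragingRT
open T4TiltOscillation (bdev)
open ExpMeanLog (expMeanLogSU deltaSU)
open Summit.QuantumFields.YangMills.Theorems.FluctuationComparisonRegPrIntLS2BetaRelativeKeyLemmaTorusHist (relKeyLemma_torus_hist)
open Summit.QuantumFields.YangMills.Theorems.FluctuationComparisonRegPrIntLS2BetaRelativeKeyLemmaSuppliers (loop_supplier_SU axial_supplier stair_supplier)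
open Summit.QuantumFields.YangMills.Theorems.FluctuationComparisonRegPrIntLS2BetaRelativeStokes (dist1_mul_inv_eq_rel)

variable {P : Params} {n : Type*} [Fintype n] [DecidableEq n] [Nonempty n]

/-- The per-level chord coefficient `qd_s` of the tower bound is nonnegative. [folklore] -/
theorem coef_nonneg (θ θ₀ : ℕ → ℝ) (s : ℕ) (hθ : 0 ≤ θ s) (hθ₀ : 0 ≤ θ₀ s) :
    0 ≤ ((1400000 * ((((P.d + 2) * P.L : ℕ) : ℝ) ^ 2 * θ s)) * ((((P.d + 2) * P.L : ℕ) : ℝ) ^ 2 / 4 * (2 * θ₀ s * ((((P.d + 2) * P.L : ℕ) : ℝ) + 2))) + (700000 * ((((P.d + 2) * P.L : ℕ) : ℝ) ^ 2 * θ₀ s)) * (((P.d + 2) * P.L : ℕ) : ℝ) + 5 * (P.L : ℝ) ^ 3 * θ₀ s) * √(((3 ^ P.d * P.L ^ P.d * P.d : ℕ) : ℝ) * ((3 ^ P.d * P.d ^ 2 : ℕ) : ℝ)) := by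
  positivity

set_option maxHeartbeats 400000 in
/-- ★★★ **THE WINDOW-FREE RELATIVE KEY LEMMA TOWER IN STAGE-GAUGE CURRENCY** (`SU(N)`, `d = 3`; inputs in the module docstring). [cite: Balaban1985Averaging, (19) p.21; Balaban1985RegularSpaces, Lemma 1 p.79] -/
theorem relKeyLemma_torus_gauged (hd : P.d = 3) {m : ℕ} (hm : m ≤ P.m + P.K) (U U₀ : GaugeField P 0 (Matrix.specialUnitaryGroup n ℂ))
    (g g₀ : (j : ℕ) → GaugeTransf P j (Matrix.specialUnitaryGroup n ℂ))
    (h3 : ∀ j, j ≤ m → Averaging.iter (fun k => blockAvg (P := P) (j := k) (expMeanLogSU (n := n))) j (GaugeField.gaugeAct (g 0) U) = GaugeField.gaugeAct (g j) (Averaging.iter (fun k => blockAvg (P := P) (j := k) (expMeanLogSU (n := n))) j U))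
    (h3' : ∀ j, j ≤ m → Averaging.iter (fun k => blockAvg (P := P) (j := k) (expMeanLogSU (n := n))) j (GaugeField.gaugeAct (g₀ 0) U₀) = GaugeField.gaugeAct (g₀ j) (Averaging.iter (fun k => blockAvg (P := P) (j := k) (expMeanLogSU (n := n))) j U₀))
    (θ θ₀ : ℕ → ℝ) (hθ₀0 : ∀ t, 0 < θ₀ t) (hθ₀θ : ∀ t, θ₀ t ≤ θ t)
    (hθ : ∀ t, t < m → (((P.d + 2) * P.L : ℕ) : ℝ) ^ 2 * θ t ≤ 1 / 800) (hδ : ∀ t, t < m → (((P.d + 2) * P.L : ℕ) : ℝ) ^ 2 / 4 * θ t < deltaSU n)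
    {X : ℝ} (hX : Real.exp (∑ i ∈ range m, (26 * ((((P.d + 2) * P.L : ℕ) : ℝ) ^ 2 * θ i) +
          ((1400000 * ((((P.d + 2) * P.L : ℕ) : ℝ) ^ 2 * θ i)) * ((((P.d + 2) * P.L : ℕ) : ℝ) ^ 2 / 4) + (700000 * ((((P.d + 2) * P.L : ℕ) : ℝ) ^ 2 * θ₀ i)) * 0) * √(((3 ^ P.d * P.L ^ P.d * P.d ^ 2 : ℕ) : ℝ) * ((3 ^ P.d * P.d ^ 2 : ℕ) : ℝ)) / Real.sqrt (P.L : ℝ))) ≤ X)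
    (hU : ∀ t, t < m → PlaqSmall (θ t) (GaugeField.gaugeAct (g t) (Averaging.iter (fun k => blockAvg (P := P) (j := k) (expMeanLogSU (n := n))) t U))) (hU₀ : ∀ t, t < m → PlaqSmall (θ₀ t) (GaugeField.gaugeAct (g₀ t) (Averaging.iter (fun k => blockAvg (P := P) (j := k) (expMeanLogSU (n := n))) t U₀))) :
    ∀ t, t ≤ m →
      √(∑ q : Plaq P t, dist1 ((GaugeField.plaqHol (GaugeField.gaugeAct (g₀ t) (Averaging.iter (fun k => blockAvg (P := P) (j := k) (expMeanLogSU (n := n))) t U₀)) q)⁻¹ * GaugeField.plaqHol (GaugeField.gaugeAct (g t) (Averaging.iter (fun k => blockAvg (P := P) (j := k) (expMeanLogSU (n := n))) t U)) q) ^ 2) ≤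
        X *
          (Real.sqrt (P.L : ℝ) ^ t * √(∑ p : Plaq P 0, dist1 ((GaugeField.plaqHol (GaugeField.gaugeAct (g₀ 0) U₀) p)⁻¹ * GaugeField.plaqHol (GaugeField.gaugeAct (g 0) U) p) ^ 2) +
            ∑ s ∈ range t, Real.sqrt (P.L : ℝ) ^ (t - 1 - s) * (((1400000 * ((((P.d + 2) * P.L : ℕ) : ℝ) ^ 2 * θ s)) * ((((P.d + 2) * P.L : ℕ) : ℝ) ^ 2 / 4 * (2 * θ₀ s * ((((P.d + 2) * P.L : ℕ) : ℝ) + 2))) + (700000 * ((((P.d + 2) * P.L : ℕ) : ℝ) ^ 2 * θ₀ s)) * (((P.d + 2) * P.L : ℕ) : ℝ) + 5 * (P.L : ℝ) ^ 3 * θ₀ s) * √(((3 ^ P.d * P.L ^ P.d * P.d : ℕ) : ℝ) * ((3 ^ P.d * P.d ^ 2 : ℕ) : ℝ)) *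
              √(∑ b : PBond P s, dist1 (GaugeField.gaugeAct (g s) (Averaging.iter (fun k => blockAvg (P := P) (j := k) (expMeanLogSU (n := n))) s U) b * (GaugeField.gaugeAct (g₀ s) (Averaging.iter (fun k => blockAvg (P := P) (j := k) (expMeanLogSU (n := n))) s U₀) b)⁻¹) ^ 2))) := by
  classical
  have hlev : ∀ t, t < m → t + 1 ≤ P.m + P.K := fun t ht => by omega
  have hθ0 : ∀ t, 0 ≤ θ t := fun t => (hθ₀0 t).le.trans (hθ₀θ t)
  -- the towers of the gauge-fixed pair are the gauge-fixed towers ((T3)), read on the SMALL per-level statements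
  have hUs : ∀ t, t < m → PlaqSmall (θ t) (Averaging.iter (fun k => blockAvg (P := P) (j := k) (expMeanLogSU (n := n))) t (GaugeField.gaugeAct (g 0) U)) := fun t ht => by rw [h3 t ht.le]; exact hU t ht
  have hU₀s : ∀ t, t < m → PlaqSmall (θ₀ t) (Averaging.iter (fun k => blockAvg (P := P) (j := k) (expMeanLogSU (n := n))) t (GaugeField.gaugeAct (g₀ 0) U₀)) := fun t ht => by rw [h3' t ht.le]; exact hU₀ t ht
  -- ### the window-free relative key lemma at the pair, the three local suppliers plugged in
  have HK := relKeyLemma_torus_hist (P := P) (n := n) hd hm (GaugeField.gaugeAct (g 0) U) (GaugeField.gaugeAct (g₀ 0) U₀) θ θ₀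
    (fun t => (((P.d + 2) * P.L : ℕ) : ℝ) ^ 2 / 4 * (2 * θ₀ t * ((((P.d + 2) * P.L : ℕ) : ℝ) + 2))) (fun _ => (((P.d + 2) * P.L : ℕ) : ℝ) ^ 2 / 4) (fun _ => (((P.d + 2) * P.L : ℕ) : ℝ)) (fun _ => 0)
    (fun t _ => (hθ₀0 t).le) (fun t _ => hθ₀θ t) hθ hδ hUs hU₀s
    (fun t Q => (((P.d + 2) * P.L : ℕ) : ℝ) ^ 2 / 4 *
      (∑ q ∈ Finset.univ.filter (fun q : Plaq P t => ∀ κ, blockOf q.src κ = Q.src κ ∨ blockOf q.src κ = Q.src κ + 1 ∨ blockOf q.src κ = Q.src κ - 1), dist1 ((GaugeField.plaqHol (Averaging.iter (fun k => blockAvg (P := P) (j := k) (expMeanLogSU (n := n))) t (GaugeField.gaugeAct (g₀ 0) U₀)) q)⁻¹ * GaugeField.plaqHol (Averaging.iter (fun k => blockAvg (P := P) (j := k) (expMeanLogSU (n := n))) t (GaugeField.gaugeAct (g 0) U)) q) +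
        2 * θ₀ t * (((((P.d + 2) * P.L : ℕ) : ℝ) + 2) * ∑ c ∈ Finset.univ.filter (fun c : PBond P t => ∀ κ, blockOf c.src κ = Q.src κ ∨ blockOf c.src κ = Q.src κ + 1 ∨ blockOf c.src κ = Q.src κ - 1), dist1 (bdev (Averaging.iter (fun k => blockAvg (P := P) (j := k) (expMeanLogSU (n := n))) t (GaugeField.gaugeAct (g 0) U)) (Averaging.iter (fun k => blockAvg (P := P) (j := k) (expMeanLogSU (n := n))) t (GaugeField.gaugeAct (g₀ 0) U₀)) c))))
    (fun t Q => (((P.d + 2) * P.L : ℕ) : ℝ) * ∑ c ∈ Finset.univ.filter (fun c : PBond P t => ∀ κ, blockOf c.src κ = Q.src κ ∨ blockOf c.src κ = Q.src κ + 1 ∨ blockOf c.src κ = Q.src κ - 1), dist1 (bdev (Averaging.iter (fun k => blockAvg (P := P) (j := k) (expMeanLogSU (n := n))) t (GaugeField.gaugeAct (g 0) U)) (Averaging.iter (fun k => blockAvg (P := P) (j := k) (expMeanLogSU (n := n))) t (GaugeField.gaugeAct (g₀ 0) U₀)) c))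
    (fun t _ Q => by
      have h1 : 0 ≤ ∑ q ∈ Finset.univ.filter (fun q : Plaq P t => ∀ κ, blockOf q.src κ = Q.src κ ∨ blockOf q.src κ = Q.src κ + 1 ∨ blockOf q.src κ = Q.src κ - 1), dist1 ((GaugeField.plaqHol (Averaging.iter (fun k => blockAvg (P := P) (j := k) (expMeanLogSU (n := n))) t (GaugeField.gaugeAct (g₀ 0) U₀)) q)⁻¹ * GaugeField.plaqHol (Averaging.iter (fun k => blockAvg (P := P) (j := k) (expMeanLogSU (n := n))) t (GaugeField.gaugeAct (g 0) U)) q) :=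
        Finset.sum_nonneg fun _ _ => GaugeGroup.dist1_nonneg _
      have h2 : 0 ≤ ∑ c ∈ Finset.univ.filter (fun c : PBond P t => ∀ κ, blockOf c.src κ = Q.src κ ∨ blockOf c.src κ = Q.src κ + 1 ∨ blockOf c.src κ = Q.src κ - 1), dist1 (bdev (Averaging.iter (fun k => blockAvg (P := P) (j := k) (expMeanLogSU (n := n))) t (GaugeField.gaugeAct (g 0) U)) (Averaging.iter (fun k => blockAvg (P := P) (j := k) (expMeanLogSU (n := n))) t (GaugeField.gaugeAct (g₀ 0) U₀)) c) := Finset.sum_nonneg fun _ _ => GaugeGroup.dist1_nonneg _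
      have h3 := (hθ₀0 t).le
      positivity)
    (fun t _ Q => by
      have h2 : 0 ≤ ∑ c ∈ Finset.univ.filter (fun c : PBond P t => ∀ κ, blockOf c.src κ = Q.src κ ∨ blockOf c.src κ = Q.src κ + 1 ∨ blockOf c.src κ = Q.src κ - 1), dist1 (bdev (Averaging.iter (fun k => blockAvg (P := P) (j := k) (expMeanLogSU (n := n))) t (GaugeField.gaugeAct (g 0) U)) (Averaging.iter (fun k => blockAvg (P := P) (j := k) (expMeanLogSU (n := n))) t (GaugeField.gaugeAct (g₀ 0) U₀)) c) := Finset.sum_nonneg fun _ _ => GaugeGroup.dist1_nonneg _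
      positivity)
    (fun t _ => by have := (hθ₀0 t).le; positivity) (fun _ _ => by positivity) (fun _ _ => by positivity) (fun _ _ => le_rfl)
    (fun t ht Q c hc i => loop_supplier_SU (hlev t ht) _ _ (hθ₀0 t).le (hU₀s t ht) Q c hc i)
    (fun t ht Q c hc => axial_supplier (hlev t ht) _ _ Q c hc)
    (fun t ht Q i => stair_supplier (hlev t ht) _ _ Q i)
    (fun t _ Q => le_of_eq (by ring))
    (fun t _ Q => by simp)
  intro t ht
  -- ### the two sides in stage-gauge currency (per summand: small rewrites only)
  have hA : ∀ s, s ≤ m →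
      √(∑ p, dist1 ((GaugeField.plaqHol (Averaging.iter (fun k => blockAvg (P := P) (j := k) (expMeanLogSU (n := n))) s (GaugeField.gaugeAct (g₀ 0) U₀)) p)⁻¹ * GaugeField.plaqHol (Averaging.iter (fun k => blockAvg (P := P) (j := k) (expMeanLogSU (n := n))) s (GaugeField.gaugeAct (g 0) U)) p) ^ 2) =
        √(∑ q, dist1 ((GaugeField.plaqHol (GaugeField.gaugeAct (g₀ s) (Averaging.iter (fun k => blockAvg (P := P) (j := k) (expMeanLogSU (n := n))) s U₀)) q)⁻¹ * GaugeField.plaqHol (GaugeField.gaugeAct (g s) (Averaging.iter (fun k => blockAvg (P := P) (j := k) (expMeanLogSU (n := n))) s U)) q) ^ 2) := fun s hs =>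
    congrArg Real.sqrt (Finset.sum_congr rfl fun p _ => by rw [h3 s hs, h3' s hs])
  have hBq : ∀ s, s ≤ m →
      √(∑ c, dist1 (bdev (Averaging.iter (fun k => blockAvg (P := P) (j := k) (expMeanLogSU (n := n))) s (GaugeField.gaugeAct (g 0) U)) (Averaging.iter (fun k => blockAvg (P := P) (j := k) (expMeanLogSU (n := n))) s (GaugeField.gaugeAct (g₀ 0) U₀)) c) ^ 2) = √(∑ b, dist1 (GaugeField.gaugeAct (g s) (Averaging.iter (fun k => blockAvg (P := P) (j := k) (expMeanLogSU (n := n))) s U) b * (GaugeField.gaugeAct (g₀ s) (Averaging.iter (fun k => blockAvg (P := P) (j := k) (expMeanLogSU (n := n))) s U₀) b)⁻¹) ^ 2) := fun s hs =>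
    congrArg Real.sqrt (Finset.sum_congr rfl fun b _ => by rw [bdev, ← dist1_mul_inv_eq_rel, h3 s hs, h3' s hs])
  have hSum : ∀ s ∈ range t, Real.sqrt (P.L : ℝ) ^ (t - 1 - s) * (((1400000 * ((((P.d + 2) * P.L : ℕ) : ℝ) ^ 2 * θ s)) * ((((P.d + 2) * P.L : ℕ) : ℝ) ^ 2 / 4 * (2 * θ₀ s * ((((P.d + 2) * P.L : ℕ) : ℝ) + 2))) + (700000 * ((((P.d + 2) * P.L : ℕ) : ℝ) ^ 2 * θ₀ s)) * (((P.d + 2) * P.L : ℕ) : ℝ) + 5 * (P.L : ℝ) ^ 3 * θ₀ s) * √(((3 ^ P.d * P.L ^ P.d * P.d : ℕ) : ℝ) * ((3 ^ P.d * P.d ^ 2 : ℕ) : ℝ)) *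
        √(∑ c, dist1 (bdev (Averaging.iter (fun k => blockAvg (P := P) (j := k) (expMeanLogSU (n := n))) s (GaugeField.gaugeAct (g 0) U)) (Averaging.iter (fun k => blockAvg (P := P) (j := k) (expMeanLogSU (n := n))) s (GaugeField.gaugeAct (g₀ 0) U₀)) c) ^ 2)) =
      Real.sqrt (P.L : ℝ) ^ (t - 1 - s) * (((1400000 * ((((P.d + 2) * P.L : ℕ) : ℝ) ^ 2 * θ s)) * ((((P.d + 2) * P.L : ℕ) : ℝ) ^ 2 / 4 * (2 * θ₀ s * ((((P.d + 2) * P.L : ℕ) : ℝ) + 2))) + (700000 * ((((P.d + 2) * P.L : ℕ) : ℝ) ^ 2 * θ₀ s)) * (((P.d + 2) * P.L : ℕ) : ℝ) + 5 * (P.L : ℝ) ^ 3 * θ₀ s) * √(((3 ^ P.d * P.L ^ P.d * P.d : ℕ) : ℝ) * ((3 ^ P.d * P.d ^ 2 : ℕ) : ℝ)) * √(∑ b, dist1 (GaugeField.gaugeAct (g s) (Averaging.iter (fun k => blockAvg (P := P) (j := k) (expMeanLogSU (n := n))) s U) b * (GaugeField.gaugeAct (g₀ s) (Averaging.iter (fun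 k => blockAvg (P := P) (j := k) (expMeanLogSU (n := n))) s U₀) b)⁻¹) ^ 2)) := fun s hs => by
    have hs' : s ≤ m := by have := Finset.mem_range.mp hs; omega
    rw [hBq s hs']
  calc √(∑ q, dist1 ((GaugeField.plaqHol (GaugeField.gaugeAct (g₀ t) (Averaging.iter (fun k => blockAvg (P := P) (j := k) (expMeanLogSU (n := n))) t U₀)) q)⁻¹ * GaugeField.plaqHol (GaugeField.gaugeAct (g t) (Averaging.iter (fun k => blockAvg (P := P) (j := k) (expMeanLogSU (n := n))) t U)) q) ^ 2)
      ≤ _ := (hA t ht).symm.le.trans (HK t ht)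
    _ = _ := congrArg₂ (· * ·) rfl (congrArg₂ (· + ·) rfl (Finset.sum_congr rfl hSum))
    _ ≤ _ := mul_le_mul_of_nonneg_right hX (add_nonneg (mul_nonneg (pow_nonneg (Real.sqrt_nonneg _) _) (Real.sqrt_nonneg _))
        (Finset.sum_nonneg fun s _ => mul_nonneg (pow_nonneg (Real.sqrt_nonneg _) _)
          (mul_nonneg (coef_nonneg θ θ₀ s (hθ0 s) (hθ₀0 s).le) (Real.sqrt_nonneg _))))

end Summit.QuantumFields.YangMills.Theorems.FluctuationComparisonRegPrIntLS2BetaRelativeKeyLemmaTorusGauged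

end
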